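import Mathlib
import HarnessLib
import Summits.ResolutionOfSingularities.ResolutionOfSingularities.Theorems.WildQuotientsWildQuotientResolutionS1aSymChartModel
import Summits.ResolutionOfSingularities.ResolutionOfSingularities.Theorems.WildQuotientsWildQuotientResolutionS1aSymChartMember
import Summits.ResolutionOfSingularities.ResolutionOfSingularities.Theorems.WildQuotientsWildQuotientResolutionS1aKillLeafFamily
import Summits.ResolutionOfSingularities.ResolutionOfSingularities.Theorems.WildQuotientsWildQuotientResolutionS1aA1KillsIn

/-!
# S1a — `a1_killsIn_two`: the a1 datum is a TWO-SHOT kill (symmetric root (x₀:3, x₁:1, x₂:1; δ2) + ONE parallel two-component kill)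

[OURS · L1 W4.5c · lead-1 g15; plan-1 RULING R-F15l (2) «R3 := `lines_killsIn_two`; corollaries `a1_killsIn_two` / `d4_killsIn_two` welcome as TESTS (originals stay)»,
lead-1 ANSWER Q-R3 (the depth 3 of I-2 ✓`a1_killsIn_three` was a ROOT-CHOICE artefact); bricks ✓`…S1aSymRoot`, ✓`…S1aSymCover`, ✓`…S1aSymChartModel`,
✓`…S1aSymSections`, ✓`…S1aSymMember`, parallel kill leaf ✓`…S1aKillLeafFamily`] — NOT statements of the manuscript; counted 0; AI-level work, weaker than expert
review. Crux stmt-ResolutionOfSingularities-17941 `CyclicQuotientFourfolds`, line `s1a-logminvertex` v13 (`stub_reachLowerInFX`).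

* model facts for the norm charts: `sym_normModel_dvd` (`X_j′ ∣ H_j`), `sym_eval_normModel_ne_zero` (the point `X_j′ = 1`, else `0`, is off `H_j = 0`);
* ★★★ `GameFrame.GModel.a1_killsIn_two` — for the a1 datum (σ: x₁ ↦ x₁ + x₀, x₂ ↦ x₂ + x₀, x₃ ↦ x₃ + x₁x₂; `X′` affine regular with `Γ(X′,⊤) ≃ k[x₀..x₃]`
  intertwining `g₀` with `σ`, `char k = p`): `KillsIn 2 (GModel.initial hq h₀)` — MOVE 1 the symmetric root (x₀ : 3, x₁ : 1, x₂ : 1) (✓`exists_isAdmissibleCentre_of_chartData`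
  with ✓`Sym.sym_map_le`), on every realisation the three producer charts `[x₀]` (KILLED: residual section `u₀′^{2dp}/c₀ = 1`), `N(x₁)`, `N(x₂)` (✓`exists_moveAtlas_of_node`,
  cover ✓`Sym.sym_hrad`); MOVE 2 = ONE parallel kill (✓`killsIn_one_of_disjointPrincipalFamily_datum`) of the two DISJOINT residual components `V(X₀′, X₂′) ⊂ N(x₁)` and
  `V(X₀′, X₁′) ⊂ N(x₂)` by the members ✓`exists_isPrincipalCentre_of_symMember` ((X₀′ : 2, X_j′ : 1; shift 1, β = s²), unit `H = X_{j′}′`) read in the free models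
  ✓`Sym.exists_symRootModel` / ✓`chartRingEquivAway`, separated by the transition sections `c_{j′}/c_j` (✓`coverElement_section_pin`);
* (the `ReachLowerInF(X)` corollary is ✓`exists_reachLowerF_initial_of_a1` of `…S1aA1KillsIn`, now also reachable through `a1_killsIn_two`) — the conclusion of `ReachLowerInF(X)` for every root decoration, through the depth-2 tree.
-/

set_option linter.dupNamespace false

noncomputable section

open CategoryTheory Limits AlgebraicGeometry TopologicalSpace Topology Opposite MvPolynomial
open Literature.AlgebraicGeometry.Resolution Literature.AlgebraicGeometry.RelativeSpec
open scoped LaurentPolynomial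
open Summit.ResolutionOfSingularities.ResolutionOfSingularities.Theorems.WildQuotientResolution.S1
open Summit.ResolutionOfSingularities.ResolutionOfSingularities.Theorems.WildQuotientResolution.S1.NodeAtlas
open Summit.ResolutionOfSingularities.ResolutionOfSingularities.Theorems.WildQuotientResolution.S1.CoarseChart
open Summit.ResolutionOfSingularities.ResolutionOfSingularities.Theorems.WildQuotientResolution.S1.ProducerStep
open Summit.ResolutionOfSingularities.ResolutionOfSingularities.Theorems.WildQuotientResolution.S1.NpFrame
open Summit.ResolutionOfSingularities.ResolutionOfSingularities.Theorems.WildQuotientResolution.S1.GoodCharts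
open Summit.ResolutionOfSingularities.ResolutionOfSingularities.Theorems.WildQuotientResolution.S1.BlowupCharts
open Summit.ResolutionOfSingularities.ResolutionOfSingularities.Theorems.WildQuotientResolution.S1.KillableTransport
open Summit.ResolutionOfSingularities.ResolutionOfSingularities.Theorems.WildQuotientResolution.S1.KillCert
open Summit.ResolutionOfSingularities.ResolutionOfSingularities.Theorems.WildQuotientResolution.S1.ReesBigrading
open Summit.ResolutionOfSingularities.ResolutionOfSingularities.Theorems.WildQuotientResolution.S1.NodeTransport
open Summit.ResolutionOfSingularities.ResolutionOfSingularities.Theorems.WildQuotientResolution.S1.CobordantTransport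
open Summit.ResolutionOfSingularities.ResolutionOfSingularities.Theorems.WildQuotientResolution.BlowupExit
open Summit.ResolutionOfSingularities.ResolutionOfSingularities.Theorems.WildQuotientResolution.S1.KillGlue
open Summit.ResolutionOfSingularities.ResolutionOfSingularities.Theorems.WildQuotientResolution.S1.FreeModel
open Summit.ResolutionOfSingularities.ResolutionOfSingularities.Theorems.WildQuotientResolution.S1.ModelNode

namespace Summit.ResolutionOfSingularities.ResolutionOfSingularities.Theorems.WildQuotientResolution.S1.GameFrame.GModel

variable {p : ℕ} {X' X₁ : Scheme.{0}} {q : X' ⟶ X₁} {G : Type} [Group G] {ρ : G →* Aut X'} {g₀ : G}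

/-- ★ **THE SYMMETRIC ROOT IS A LEGAL MOVE, with the explicit root node.** On the initial model of a symmetric-root datum (`σx₃ = x₃ + x₁·r`,
`e⁻¹r ∈ 𝒥_{δ−1}`), a stable affine chart `O` (meant: `O = X′`) whose ring of sections is `≃ k[x₀..x₃]` by `e`, with `g₀` acting through `e` as `σ` and
`V(e⁻¹x₀, e⁻¹x₁, e⁻¹x₂) ∩ O` closed: the centre `(e⁻¹x₀ : δ+1, e⁻¹x₁ : 1, e⁻¹x₂ : 1)` (trivial node of `O`) yields a Veronese degree `d` and an ADMISSIBLE
`G`-stable centre `𝒦` with `O` a centre chart and `(𝒦|O)_n = e′⁻¹(trace 𝒥ₙ)`. [OURS · L1 W4.5c · R3 symmetric root, scheme level] -/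
theorem sym_rootChartData [Finite G] (hp : p.Prime) (hG : ∀ g : G, g ∈ Subgroup.zpowers g₀) (hg₀ : g₀ ^ p = 1)
    (hq : ∀ g : G, (ρ g).hom ≫ q = q) [IsIntegral X'] [IsLocallyNoetherian X'] [X'.IsSeparated]
    (hreg : Scheme.IsRegular X') {k : Type} [Field k] (σ : MvPolynomial (Fin 4) k ≃+* MvPolynomial (Fin 4) k) (hC : ∀ a : k, σ (C a) = C a)
    (h0 : σ (X 0) = X 0) (h1 : σ (X 1) = X 1 + X 0) (h2 : σ (X 2) = X 2 + X 0) (δ : ℕ) (r : MvPolynomial (Fin 4) k) (h3 : σ (X 3) = X 3 + X 1 * r) (hδ : 1 ≤ δ)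
    (h₀ : NodeAtlas p (⟨ρ, hq⟩ : ActionOver q G) g₀) (O : (GModel.initial (p := p) (g₀ := g₀) hq h₀).act.StableAffineOpens) (hO : IsAffineOpen O.1)
    (e : Γ(X', O.1) ≃+* MvPolynomial (Fin 4) k) (hact : ∀ t : Γ(X', O.1), actOEquiv (GModel.initial hq h₀).act O g₀ t = e.symm (σ (e t)))
    (hr : e.symm r ∈ (weightedFiltration (e.symm ∘ ![X 0, X 1, X 2] : Fin 3 → Γ(X', O.1)) ![δ + 1, 1, 1]).ideal (δ - 1))
    (hZcl : IsClosed (X'.zeroLocus (U := O.1) (Set.range (e.symm ∘ ![X 0, X 1, X 2] : Fin 3 → Γ(X', O.1))) ∩ (O.1 : Set (GModel.initial (p := p) (g₀ := g₀) hq h₀).V))) :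
    ∃ (𝒜 : (Π j : Fin 0, ZMod ((![] : Fin 0 → ℕ) j)) → AddSubgroup Γ(X', O.1)) (_ : GradedRing 𝒜) (e' : Γ(X', O.1) ≃+* ↥(𝒜 0))
      (𝒦 : ReesFiltration X') (d : ℕ),
      (∀ i, 𝒜 i = ⊤) ∧ (∀ b, ((e' b : ↥(𝒜 0)) : Γ(X', O.1)) = b) ∧
      IsTameNode p Γ(X', O.1) 𝒜 (actOEquiv (GModel.initial hq h₀).act O g₀) ∧ (∀ x, (⇑(actOEquiv (GModel.initial hq h₀).act O g₀))^[p] x = x) ∧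
      (∀ t : Γ(X', O.1), ((e' (((GModel.initial hq h₀).act.aut g₀⁻¹).hom.appLE O.1 O.1 (O.2.1 g₀⁻¹).ge t) : ↥(𝒜 0)) : Γ(X', O.1)) =
        actOEquiv (GModel.initial hq h₀).act O g₀ ((e' t : ↥(𝒜 0)) : Γ(X', O.1))) ∧
      VeroneseNormalised 𝒜 (e.symm ∘ ![X 0, X 1, X 2]) ![δ + 1, 1, 1] d ∧
      IsAdmissibleCentre p (GModel.initial hq h₀).act g₀ 𝒦 d ∧ IsCentreChart p (GModel.initial hq h₀).act g₀ 𝒦 d O ∧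
      (∀ (g : G) (n : ℕ), (𝒦.ideal n).comap ((GModel.initial hq h₀).act.aut g).hom = 𝒦.ideal n) ∧
      (∀ n, (𝒦.filtration ⟨O.1, hO⟩).ideal n = ((traceFiltration 𝒜 (e.symm ∘ ![X 0, X 1, X 2]) ![δ + 1, 1, 1]).ideal n).comap (e' : Γ(X', O.1) →+* ↥(𝒜 0))) ∧
      (((𝒦.ideal d).support : Set X')) = X'.zeroLocus (U := O.1) (Set.range (e.symm ∘ ![X 0, X 1, X 2] : Fin 3 → Γ(X', O.1))) ∩ (O.1 : Set (GModel.initial (p := p) (g₀ := g₀) hq h₀).V) := by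
  haveI hsep : (GModel.initial (p := p) (g₀ := g₀) hq h₀).V.IsSeparated := ‹X'.IsSeparated›
  have _ := hp.pos
  obtain ⟨𝒜, gr, e', 𝒦, d, h𝒜, he', htame, hσp, hσ, -, hver, hadm, hcentre, hG𝒦, -, h𝒦tr, hsupp⟩ :=
    exists_isAdmissibleCentre_of_chartData (p := p) hG hg₀ (GModel.initial hq h₀) hreg O hO (e.symm ∘ ![X 0, X 1, X 2]) ![δ + 1, 1, 1] (by norm_num)
      (fun i => by fin_cases i <;> simp) (Sym.sym_isRegular e) (Sym.sym_isRegularRing_quotient e)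
      (Sym.sym_map_le σ hC h0 h1 h2 δ r h3 e (actOEquiv (GModel.initial hq h₀).act O g₀) hact hr hδ) hZcl
  exact ⟨𝒜, gr, e', 𝒦, d, h𝒜, he', htame, hσp, hσ, hver, hadm, hcentre, hG𝒦, h𝒦tr, hsupp⟩

set_option maxHeartbeats 12000000 in
set_option synthInstance.maxHeartbeats 400000 in
/-- ★★★ **`KillsIn 2` FOR THE INITIAL MODEL OF THE a1 DATUM** (symmetric root + one parallel two-component kill). See the module docstring.
[OURS · L1 W4.5c · R-F15l test of R3; NOT a statement of the manuscript] -/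
theorem a1_killsIn_two [Finite G] (hp : p.Prime) (hG : ∀ g : G, g ∈ Subgroup.zpowers g₀) (hg₀ : g₀ ^ p = 1)
    (hq : ∀ g : G, (ρ g).hom ≫ q = q) [IsIntegral X'] [IsLocallyNoetherian X'] [X'.IsSeparated] [IsAffine X']
    (hreg : Scheme.IsRegular X') {k' : Type} [Field k'] (φ : X₁ ⟶ Spec (.of k')) [IsSeparated φ] [LocallyOfFiniteType φ] [IsFinite q]
    {k : Type} [Field k] [CharP k p] (σ : MvPolynomial (Fin 4) k ≃+* MvPolynomial (Fin 4) k) (hC : ∀ a : k, σ (C a) = C a)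
    (h0 : σ (X 0) = X 0) (h1 : σ (X 1) = X 1 + X 0) (h2 : σ (X 2) = X 2 + X 0) (h3 : σ (X 3) = X 3 + X 1 * X 2)
    (e : Γ(X', ⊤) ≃+* MvPolynomial (Fin 4) k)
    (hστ : ∀ t : Γ(X', ⊤), e ((ρ g₀⁻¹).hom.appLE ⊤ ⊤ (by rw [Scheme.Hom.preimage_top]) t) = σ (e t))
    (h₀ : NodeAtlas p (⟨ρ, hq⟩ : ActionOver q G) g₀) :
    KillsIn 2 (GModel.initial (p := p) (g₀ := g₀) hq h₀) := by
  classical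
  haveI : NeZero p := ⟨hp.ne_zero⟩
  have hp1 : p ≠ 1 := hp.one_lt.ne'
  -- the root chart `O = X′`
  haveI : IsAffine (⊤ : X'.Opens) := isAffineOpen_top X'
  have hAff : IsAffineHom ((⊤ : X'.Opens).ι ≫ q) := inferInstance
  have hst : ∀ g : G, (ρ g).hom ⁻¹ᵁ (⊤ : X'.Opens) = ⊤ := fun g => Scheme.Hom.preimage_top _
  let O : (GModel.initial (p := p) (g₀ := g₀) hq h₀).act.StableAffineOpens := ⟨⊤, hst, hAff⟩
  have hO : IsAffineOpen O.1 := isAffineOpen_top X'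
  haveI hsep₀ : (GModel.initial (p := p) (g₀ := g₀) hq h₀).V.IsSeparated := ‹X'.IsSeparated›
  -- `e` read on `Γ(X′, O)`, kept opaque
  obtain ⟨e₀, he₀⟩ : ∃ e₀ : Γ(X', O.1) ≃+* MvPolynomial (Fin 4) k, ∀ t, e₀ t = e t := ⟨e, fun _ => rfl⟩
  have hact : ∀ t : Γ(X', O.1), actOEquiv (GModel.initial hq h₀).act O g₀ t = e₀.symm (σ (e₀ t)) := fun t => by
    apply e₀.injective
    rw [e₀.apply_symm_apply, he₀, he₀, ← hστ]
    rfl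
  -- the root automorphism, kept opaque
  obtain ⟨τ₀, hτ₀⟩ : ∃ τ₀ : Γ(X', O.1) ≃+* Γ(X', O.1), τ₀ = actOEquiv (GModel.initial hq h₀).act O g₀ := ⟨_, rfl⟩
  have hact₀ : ∀ t : Γ(X', O.1), τ₀ t = e₀.symm (σ (e₀ t)) := fun t => by rw [hτ₀]; exact hact t
  -- the symmetric centre `(e⁻¹x₀ : 3, e⁻¹x₁ : 1, e⁻¹x₂ : 1)`, tail `r = x₂`, `δ = 2`
  have hδ : 1 ≤ 2 := by norm_num
  have hr : e₀.symm (X 2) ∈ (weightedFiltration (e₀.symm ∘ ![X 0, X 1, X 2] : Fin 3 → Γ(X', O.1)) ![2 + 1, 1, 1]).ideal (2 - 1) :=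
    mem_weightedFiltration_ideal (e₀.symm ∘ ![X 0, X 1, X 2] : Fin 3 → Γ(X', O.1)) ![2 + 1, 1, 1] 2
  have hσJ := Sym.sym_map_le σ hC h0 h1 h2 2 (X 2) h3 e₀ τ₀ hact₀ hr hδ
  have hw : ∀ i, 0 < (![2 + 1, 1, 1] : Fin 3 → ℕ) i := fun i => by fin_cases i <;> norm_num
  have hK1 := Sym.sym_isRegular e₀
  have hK1' := Sym.sym_isRegularRing_quotient e₀
  have hZcl : IsClosed (X'.zeroLocus (U := O.1) (Set.range (e₀.symm ∘ ![X 0, X 1, X 2] : Fin 3 → Γ(X', O.1))) ∩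
      (O.1 : Set (GModel.initial (p := p) (g₀ := g₀) hq h₀).V)) :=
    (X'.zeroLocus_isClosed _).inter (by exact isClosed_univ)
  obtain ⟨𝒜, gr, e', 𝒦, d, h𝒜, he', htame, hσp, hσ, hver, hadm, -, hG𝒦, h𝒦tr, -⟩ :=
    sym_rootChartData hp hG hg₀ hq hreg σ hC h0 h1 h2 2 (X 2) h3 hδ h₀ O hO e₀ hact hr hZcl
  letI : GradedRing 𝒜 := gr
  have htame₀ : IsTameNode p Γ(X', O.1) 𝒜 τ₀ := by rw [hτ₀]; exact htame
  have hσp₀ : ∀ x : Γ(X', O.1), (⇑τ₀)^[p] x = x := by rw [hτ₀]; exact hσp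
  have hσ₀ : ∀ t : Γ(X', O.1), ((e' (((GModel.initial hq h₀).act.aut g₀⁻¹).hom.appLE O.1 O.1 (O.2.1 g₀⁻¹).ge t) : ↥(𝒜 0)) : Γ(X', O.1)) =
      τ₀ ((e' t : ↥(𝒜 0)) : Γ(X', O.1)) := fun t => by rw [hτ₀]; exact hσ t
  refine ⟨𝒦, d, hadm, fun M₁ hm₁ => ⟨⟨NodeAtlasData.ofNodeAtlas (p := p) (ρ := M₁.act) (g₀ := g₀) M₁.atlas⟩, ?_⟩⟩
  obtain ⟨π₁, hbl, -, hrM, hcomm⟩ := hm₁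
  haveI : M₁.V.IsSeparated := isSeparated_of_datum φ M₁
  -- ### MOVE 1 on the realisation `M₁`: the three producer charts and the atlas `𝔄₁`
  haveI hchar : CharP Γ(X', O.1) p := charP_of_injective_ringHom (f := e₀.symm.toRingHom) e₀.symm.injective p
  have hd : 0 < d := hver.1
  have hdp : 0 < d * p := Nat.mul_pos hd hp.pos
  have hk : 0 < (2 + 1) * 2 * p := Nat.mul_pos (by norm_num) hp.pos
  have hf : ∀ i, (e₀.symm ∘ ![X 0, X 1, X 2] : Fin 3 → Γ(X', O.1)) i ∈ 𝒜 ((fun _ => (0 : Π j : Fin 0, ZMod ((![] : Fin 0 → ℕ) j))) i) := fun i => by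
    rw [h𝒜]; trivial
  have hx3 : e₀.symm (X 3) ∈ 𝒜 0 := by rw [h𝒜]; trivial
  have hr0 : e₀.symm (X 2) ∈ 𝒜 0 := by rw [h𝒜]; trivial
  -- the cover `(x₀^{2dp}, N₁^{6d}, N₂^{6d})` of degree `dbar = d·(6p)`, kept opaque
  obtain ⟨a₀, ha₀⟩ : ∃ a : Γ(X', O.1), a = e₀.symm (X 0) ^ (2 * (d * p)) := ⟨_, rfl⟩
  obtain ⟨a₁, ha₁⟩ : ∃ a : Γ(X', O.1), a = (∏ i : ZMod p, (e₀.symm (X 1) + (i.val : Γ(X', O.1)) * e₀.symm (X 0))) ^ ((2 + 1) * 2 * d) := ⟨_, rfl⟩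
  obtain ⟨a₂, ha₂⟩ : ∃ a : Γ(X', O.1), a = (∏ i : ZMod p, (e₀.symm (X 2) + (i.val : Γ(X', O.1)) * e₀.symm (X 0))) ^ ((2 + 1) * 2 * d) := ⟨_, rfl⟩
  obtain ⟨y, hy0, hy1, hy2⟩ : ∃ y : Fin 3 → ↥(𝒜 0), y 0 = e' a₀ ∧ y 1 = e' a₁ ∧ y 2 = e' a₂ := ⟨![e' a₀, e' a₁, e' a₂], rfl, rfl, rfl⟩
  have hyval : ∀ j, (y j).1 = (![a₀, a₁, a₂] : Fin 3 → Γ(X', O.1)) j := fun j => by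
    fin_cases j
    · change (y 0).1 = a₀; rw [hy0]; exact he' a₀
    · change (y 1).1 = a₁; rw [hy1]; exact he' a₁
    · change (y 2).1 = a₂; rw [hy2]; exact he' a₂
  have hX1 : e₀.symm (X 1) ∈ (weightedFiltration (e₀.symm ∘ ![X 0, X 1, X 2] : Fin 3 → Γ(X', O.1)) ![2 + 1, 1, 1]).ideal 1 :=
    mem_weightedFiltration_ideal (e₀.symm ∘ ![X 0, X 1, X 2] : Fin 3 → Γ(X', O.1)) ![2 + 1, 1, 1] 1
  have hy : ∀ j, y j ∈ (traceFiltration 𝒜 (e₀.symm ∘ ![X 0, X 1, X 2] : Fin 3 → Γ(X', O.1)) ![2 + 1, 1, 1]).ideal (d * ((2 + 1) * 2 * p)) := fun j => by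
    rw [mem_traceFiltration_iff, hyval]
    fin_cases j
    · change a₀ ∈ _; rw [ha₀]; exact Sym.sym_cover_zero_mem 2 e₀ (p := p) d
    · change a₁ ∈ _; rw [ha₁]; exact Sym.sym_cover_norm_mem 2 e₀ (p := p) d 1 hX1
    · change a₂ ∈ _; rw [ha₂]; exact Sym.sym_cover_norm_mem 2 e₀ (p := p) d 2 hr
  have hσy : ∀ j, τ₀ (y j).1 = (y j).1 := fun j => by
    rw [hyval]
    fin_cases j
    · change τ₀ a₀ = a₀; rw [ha₀]; exact Sym.sym_cover_zero_fixed σ h0 e₀ τ₀ hact₀ _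
    · change τ₀ a₁ = a₁; rw [ha₁, map_pow, A1.a1_norm_fixed σ h0 h1 e₀ τ₀ hact₀ hp1]
    · change τ₀ a₂ = a₂; rw [ha₂, map_pow, Sym.sym_norm_two_fixed σ h0 h2 e₀ τ₀ hact₀ hp1]
  have hrad : ∀ i : Fin 3, cobordantAlgebra.u' (e₀.symm ∘ ![X 0, X 1, X 2] : Fin 3 → Γ(X', O.1)) ![2 + 1, 1, 1] i ∈
      (Ideal.span (Set.range fun j => coverElement 𝒜 (e₀.symm ∘ ![X 0, X 1, X 2] : Fin 3 → Γ(X', O.1)) ![2 + 1, 1, 1] (d * ((2 + 1) * 2 * p)) (y j) (hy j))).radical :=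
    fun i => Sym.sym_hrad 2 e₀ (p := p) d (fun j => coverElement 𝒜 (e₀.symm ∘ ![X 0, X 1, X 2] : Fin 3 → Γ(X', O.1)) ![2 + 1, 1, 1] (d * ((2 + 1) * 2 * p)) (y j) (hy j))
      (by rw [coe_coverElement, hyval, ← ha₀]; rfl) (by rw [coe_coverElement, hyval, ← ha₁]; rfl) (by rw [coe_coverElement, hyval, ← ha₂]; rfl) i
  have hH1 := Sym.sym_augmentationIdeal_sigmaR_le σ hC h0 h1 h2 2 (X 2) h3 e₀ τ₀ hact₀ hr hδ hp.pos hσp₀ hσJ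
  have hmem0 := Sym.sym_u'_zero_mem_residual σ h1 2 e₀ τ₀ hact₀ hp.pos hσp₀ hσJ
  have hmem1 := Sym.sym_u'_one_mul_mem_residual σ 2 (X 2) h3 e₀ τ₀ hact₀ hr hδ hp.pos hσp₀ hσJ
  have hz0 := fun j => Sym.sym_residualSection_zero 2 e₀ (p := p) ![] 𝒜 hf (y j) (hy j) d rfl _ hmem0 (Nat.mul_pos two_pos hdp)
  have hz1 := fun j => Sym.sym_residualSection_one 2 (X 2) e₀ hr hδ (p := p) ![] 𝒜 hf hr0 (y j) (hy j) d rfl _ hmem1 (Nat.mul_pos (by norm_num) hdp)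
  have hsuppO : (((𝒦.ideal d).support : Set X')) ⊆ (O.1 : Set (GModel.initial (p := p) (g₀ := g₀) hq h₀).V) := fun x _ => Set.mem_univ x
  obtain ⟨OW, hOWaff, hOWeq, E, htame', hE, hpin, 𝔄₁, hF₁⟩ := exists_moveAtlas_of_node hp.pos hG (GModel.initial hq h₀) M₁
    (NodeAtlasData.ofNodeAtlas (p := p) (ρ := (⟨ρ, hq⟩ : ActionOver q G)) (g₀ := g₀) h₀) O hO
    ![] 𝒜 (e₀.symm ∘ ![X 0, X 1, X 2]) ![2 + 1, 1, 1] hf τ₀ e' htame₀ hσp₀ hσ₀ hw hK1 hK1' hσJ 𝒦 d hG𝒦 h𝒦tr hver hsuppO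
    π₁ hbl hrM hcomm hk y hy hσy hrad (cobordantAlgebra.s (e₀.symm ∘ ![X 0, X 1, X 2]) ![2 + 1, 1, 1] ^ 2) hH1 (fun _ => 2)
    (fun j => ![algebraMap _ (ChartRing 𝒜 (e₀.symm ∘ ![X 0, X 1, X 2]) ![2 + 1, 1, 1] (d * ((2 + 1) * 2 * p)) (y j) (hy j))
        (cobordantAlgebra.u' (e₀.symm ∘ ![X 0, X 1, X 2]) ![2 + 1, 1, 1] 0 ^ (2 * (d * p))) *
      IsLocalization.Away.invSelf (coverElement 𝒜 (e₀.symm ∘ ![X 0, X 1, X 2]) ![2 + 1, 1, 1] (d * ((2 + 1) * 2 * p)) (y j) (hy j)),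
      algebraMap _ (ChartRing 𝒜 (e₀.symm ∘ ![X 0, X 1, X 2]) ![2 + 1, 1, 1] (d * ((2 + 1) * 2 * p)) (y j) (hy j))
        ((cobordantAlgebra.u' (e₀.symm ∘ ![X 0, X 1, X 2]) ![2 + 1, 1, 1] 1 * ⟨_, C_mul_T_mem_cobordantAlgebra _ _ hr⟩) ^ ((2 + 1) * (d * p))) *
      IsLocalization.Away.invSelf (coverElement 𝒜 (e₀.symm ∘ ![X 0, X 1, X 2]) ![2 + 1, 1, 1] (d * ((2 + 1) * 2 * p)) (y j) (hy j))])
    (fun j l => by fin_cases l; exacts [(hz0 j).1, (hz1 j).1]) (fun j l => by fin_cases l; exacts [(hz0 j).2, (hz1 j).2])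
  have hWle : ∀ j, (OW j).1 ≤ π₁ ⁻¹ᵁ O.1 := fun j => by rw [hOWeq j]; exact blowupChart_le_preimage π₁ _ ⟨O.1, hO⟩ _
  -- ### chart 0 is killed: its first residual section is `1`
  have hy0val : ((y 0 : ↥(𝒜 0)) : Γ(X', O.1)) = e₀.symm (X 0) ^ (2 * (d * p)) := by rw [hyval, ← ha₀]; rfl
  have hy1val : ((y 1 : ↥(𝒜 0)) : Γ(X', O.1)) = (∏ i : ZMod p, (e₀.symm (X 1) + (i.val : Γ(X', O.1)) * e₀.symm (X 0))) ^ ((2 + 1) * 2 * d) := by rw [hyval, ← ha₁]; rfl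
  have hy2val : ((y 2 : ↥(𝒜 0)) : Γ(X', O.1)) = (∏ i : ZMod p, (e₀.symm (X 2) + (i.val : Γ(X', O.1)) * e₀.symm (X 0))) ^ ((2 + 1) * 2 * d) := by rw [hyval, ← ha₂]; rfl
  have hc0 := Sym.sym_coverElement_zero_eq 2 e₀ (p := p) ![] 𝒜 (y 0) (hy 0) d rfl hy0val
  have hunit0 : algebraMap _ (ChartRing 𝒜 (e₀.symm ∘ ![X 0, X 1, X 2]) ![2 + 1, 1, 1] (d * ((2 + 1) * 2 * p)) (y 0) (hy 0))
        (cobordantAlgebra.u' (e₀.symm ∘ ![X 0, X 1, X 2]) ![2 + 1, 1, 1] 0 ^ (2 * (d * p))) *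
      IsLocalization.Away.invSelf (coverElement 𝒜 (e₀.symm ∘ ![X 0, X 1, X 2]) ![2 + 1, 1, 1] (d * ((2 + 1) * 2 * p)) (y 0) (hy 0)) = 1 := by
    rw [← hc0]; exact IsLocalization.Away.mul_invSelf _
  have hz0W : ∀ v ∈ (OW 0).1, v ∈ M₁.V.basicOpen
      (letI := chartNodeGradedRing ![] 𝒜 (e₀.symm ∘ ![X 0, X 1, X 2]) ![2 + 1, 1, 1] hf (d * ((2 + 1) * 2 * p)) (y 0) (hy 0); (E 0).symm ⟨_, (hz0 0).1⟩) := fun v hv => by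
    letI := chartNodeGradedRing ![] 𝒜 (e₀.symm ∘ ![X 0, X 1, X 2]) ![2 + 1, 1, 1] hf (d * ((2 + 1) * 2 * p)) (y 0) (hy 0)
    have h1 : (⟨_, (hz0 0).1⟩ : ↥(chartNodeGrading ![] 𝒜 (e₀.symm ∘ ![X 0, X 1, X 2]) ![2 + 1, 1, 1] hf (d * ((2 + 1) * 2 * p)) (y 0) (hy 0) 0)) = 1 := Subtype.ext hunit0
    rw [h1, map_one, Scheme.basicOpen_of_isUnit _ isUnit_one]
    exact hv
  have hF₁W : 𝔄₁.fLocus ⊆ ⋃ c : Fin 2, (((![OW 1, OW 2] : Fin 2 → M₁.act.StableAffineOpens) c).1 : Set M₁.V) := by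
    intro v hv
    rcases hF₁ hv with hold | hnew
    · exact absurd (Set.mem_univ _) hold.2
    · obtain ⟨j, hvW, hvR⟩ := Set.mem_iUnion.mp hnew
      revert hvW hvR
      refine Fin.cases ?_ (fun j' => Fin.cases ?_ (fun j'' => Fin.cases ?_ (fun j''' => j'''.elim0) j'') j') j
      · intro hvW hvR; exact absurd (hz0W v hvW) (hvR 0)
      · intro hvW _; exact Set.mem_iUnion.mpr ⟨0, hvW⟩
      · intro hvW _; exact Set.mem_iUnion.mpr ⟨1, hvW⟩
  -- ### the three charts cover `M₁`
  have hπ' : IsBlowup π₁ ((𝒦.ideal d) ^ ((2 + 1) * 2 * p)) := isBlowup_pow hbl hk.ne'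
  have hverbar := CoarseChart.veroneseNormalised_mul 𝒜 _ _ hver hk
  have hJ' : ((𝒦.ideal d) ^ ((2 + 1) * 2 * p)).ideal ⟨O.1, hO⟩ =
      ((traceFiltration 𝒜 (e₀.symm ∘ ![X 0, X 1, X 2]) ![2 + 1, 1, 1]).ideal (d * ((2 + 1) * 2 * p))).comap (e' : Γ(X', O.1) →+* ↥(𝒜 0)) := by
    rw [Scheme.IdealSheafData.ideal_pow, Pi.pow_apply, ← ReesFiltration.filtration_ideal, h𝒦tr d, hver.2 ((2 + 1) * 2 * p), comap_equiv_pow]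
  have hxJ : ∀ j, e'.symm (y j) ∈ ((𝒦.ideal d) ^ ((2 + 1) * 2 * p)).ideal ⟨O.1, hO⟩ := fun j => by
    rw [hJ', Ideal.mem_comap, RingHom.coe_coe, e'.apply_symm_apply]; exact hy j
  have hcovM : ∀ x : M₁.V, x ∈ (OW 0).1 ∨ x ∈ (OW 1).1 ∨ x ∈ (OW 2).1 := by
    intro x
    have hcovW := iSup_blowupChart_eq_preimage (I := 𝒦.ideal d) (GModel.initial hq h₀).act ![] 𝒜 (e₀.symm ∘ ![X 0, X 1, X 2]) ![2 + 1, 1, 1] hf O hO e' hπ' hverbar hJ' y hy hrad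
    have hx : x ∈ ⨆ j, blowupChart π₁ ((𝒦.ideal d) ^ ((2 + 1) * 2 * p)) ⟨O.1, hO⟩ (e'.symm (y j)) :=
      (congrArg (fun U : M₁.V.Opens => x ∈ U) hcovW).mpr (Set.mem_univ _)
    obtain ⟨j, hj⟩ := Opens.mem_iSup.mp hx
    revert hj
    refine Fin.cases ?_ (fun j' => Fin.cases ?_ (fun j'' => Fin.cases ?_ (fun j''' => j'''.elim0) j'') j') j
    · intro hj; exact Or.inl ((congrArg (fun U : M₁.V.Opens => x ∈ U) (hOWeq 0)).mpr hj)
    · intro hj; exact Or.inr (Or.inl ((congrArg (fun U : M₁.V.Opens => x ∈ U) (hOWeq 1)).mpr hj))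
    · intro hj; exact Or.inr (Or.inr ((congrArg (fun U : M₁.V.Opens => x ∈ U) (hOWeq 2)).mpr hj))
  -- ### the transition sections `c_{j′}/c_j` on the chart `j`: units on `W_j ∩ W_{j′}`
  have htrans : ∀ j j' : Fin 3, letI := chartNodeGradedRing ![] 𝒜 (e₀.symm ∘ ![X 0, X 1, X 2]) ![2 + 1, 1, 1] hf (d * ((2 + 1) * 2 * p)) (y j) (hy j)
      ∃ t : Γ(M₁.V, (OW j).1),
        ((E j t : ↥(chartNodeGrading ![] 𝒜 (e₀.symm ∘ ![X 0, X 1, X 2]) ![2 + 1, 1, 1] hf (d * ((2 + 1) * 2 * p)) (y j) (hy j) 0)) :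
            ChartRing 𝒜 (e₀.symm ∘ ![X 0, X 1, X 2]) ![2 + 1, 1, 1] (d * ((2 + 1) * 2 * p)) (y j) (hy j)) =
          algebraMap _ (ChartRing 𝒜 (e₀.symm ∘ ![X 0, X 1, X 2]) ![2 + 1, 1, 1] (d * ((2 + 1) * 2 * p)) (y j) (hy j))
              (coverElement 𝒜 (e₀.symm ∘ ![X 0, X 1, X 2]) ![2 + 1, 1, 1] (d * ((2 + 1) * 2 * p)) (y j') (hy j')) *
            IsLocalization.Away.invSelf (coverElement 𝒜 (e₀.symm ∘ ![X 0, X 1, X 2]) ![2 + 1, 1, 1] (d * ((2 + 1) * 2 * p)) (y j) (hy j)) ∧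
        ∀ v ∈ (OW j).1, v ∈ (OW j').1 → v ∈ M₁.V.basicOpen t := by
    intro j j'
    letI := chartNodeGradedRing ![] 𝒜 (e₀.symm ∘ ![X 0, X 1, X 2]) ![2 + 1, 1, 1] hf (d * ((2 + 1) * 2 * p)) (y j) (hy j)
    have hmem := transitionSection_mem_chartNodeGrading_zero ![] 𝒜 (e₀.symm ∘ ![X 0, X 1, X 2]) ![2 + 1, 1, 1] hf (y j) (hy j) (y j') (hy j')
    have hpz : (E j).symm ⟨_, hmem⟩ * π₁.appLE O.1 (OW j).1 (hWle j) (e'.symm (y j)) = π₁.appLE O.1 (OW j).1 (hWle j) (e'.symm (y j')) :=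
      symm_mul_appLE_eq_of_pin π₁ O.1 (OW j).1 (hWle j) (chartNodeGrading ![] 𝒜 (e₀.symm ∘ ![X 0, X 1, X 2]) ![2 + 1, 1, 1] hf (d * ((2 + 1) * 2 * p)) (y j) (hy j)) (E j) e'
        (toChartRing 𝒜 (e₀.symm ∘ ![X 0, X 1, X 2]) ![2 + 1, 1, 1] (d * ((2 + 1) * 2 * p)) (y j) (hy j)) (hpin j (hWle j)) ⟨_, hmem⟩ (e'.symm (y j')) (e'.symm (y j)) (y j') (y j)
        (e'.apply_symm_apply _) (e'.apply_symm_apply _) (coverElement_section_pin ![] 𝒜 (e₀.symm ∘ ![X 0, X 1, X 2]) ![2 + 1, 1, 1] (y j) (hy j) (y j') (hy j'))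
    refine ⟨(E j).symm ⟨_, hmem⟩, by rw [(E j).apply_symm_apply], fun v hvW hv' => ?_⟩
    exact mem_basicOpen_of_mem_blowupChart_of_mul_appLE_eq hπ' ⟨O.1, hO⟩ (hxJ j) (le_of_eq (hOWeq j)) _ hpz hvW
      ((congrArg (fun U : M₁.V.Opens => v ∈ U) (hOWeq j')).mp hv')
  obtain ⟨t₁₀, ht₁₀E, ht₁₀U⟩ := htrans 1 0
  obtain ⟨t₁₂, ht₁₂E, ht₁₂U⟩ := htrans 1 2
  obtain ⟨t₂₀, ht₂₀E, ht₂₀U⟩ := htrans 2 0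
  obtain ⟨t₂₁, ht₂₁E, ht₂₁U⟩ := htrans 2 1
  -- ### the free models of the charts `N(x₁)`, `N(x₂)`
  obtain ⟨Ψ, hΨa, hΨs, hΨ0, hΨ1, hΨ2⟩ := Sym.exists_symRootModel 2 e₀
  have hΨc0 : Ψ (coverElement 𝒜 (e₀.symm ∘ ![X 0, X 1, X 2]) ![2 + 1, 1, 1] (d * ((2 + 1) * 2 * p)) (y 0) (hy 0)) = X (some 0) ^ (2 * (d * p)) := by
    rw [hc0, map_pow, hΨ0]
  have hΨcn : ∀ (j : Fin 4) (yj : ↥(𝒜 0)) (hyj : yj ∈ (traceFiltration 𝒜 (e₀.symm ∘ ![X 0, X 1, X 2]) ![2 + 1, 1, 1]).ideal (d * ((2 + 1) * 2 * p)))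
      (U : ↥(cobordantAlgebra (e₀.symm ∘ ![X 0, X 1, X 2] : Fin 3 → Γ(X', O.1)) ![2 + 1, 1, 1]))
      (hU : (U : Γ(X', O.1)[T;T⁻¹]) = LaurentPolynomial.C (e₀.symm (X j)) * LaurentPolynomial.T 1) (hΨU : Ψ U = X (some j)),
      ((yj : Γ(X', O.1)) = (∏ i : ZMod p, (e₀.symm (X j) + (i.val : Γ(X', O.1)) * e₀.symm (X 0))) ^ ((2 + 1) * 2 * d)) →
      Ψ (coverElement 𝒜 (e₀.symm ∘ ![X 0, X 1, X 2]) ![2 + 1, 1, 1] (d * ((2 + 1) * 2 * p)) yj hyj) =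
        (∏ i : ZMod p, (X (some j) + (i.val : MvPolynomial (Option (Fin 4)) k) * (X (some 0) * X none ^ 2))) ^ ((2 + 1) * 2 * d) := by
    intro j yj hyj U hU hΨU hval
    rw [Sym.sym_coverElement_norm_eq 2 e₀ ![] 𝒜 yj hyj d rfl j hval U hU, map_pow, map_prod]
    refine congrArg (· ^ _) (Finset.prod_congr rfl fun i _ => ?_)
    rw [map_add, map_mul, map_mul, map_pow, hΨU, hΨ0, hΨs, map_natCast, map_natCast]
  have hΨc1 := hΨcn 1 (y 1) (hy 1) (cobordantAlgebra.u' _ _ 1) (by rw [cobordantAlgebra.coe_u']; rfl) hΨ1 hy1val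
  have hΨc2 := hΨcn 2 (y 2) (hy 2) (cobordantAlgebra.u' _ _ 2) (by rw [cobordantAlgebra.coe_u']; rfl) hΨ2 hy2val
  have hed : (2 + 1) * 2 * d ≠ 0 := (Nat.mul_pos (by norm_num) hd).ne'
  -- degrees of the component variables, Veronese degrees (common degree `dA·dB`)
  have dg2 := Sym.sym_model_degree_two 2 e₀ Ψ hΨ2 ![] 𝒜 hf (y 1) (hy 1)
  have dg1 := Sym.sym_model_degree_one 2 e₀ Ψ hΨ1 ![] 𝒜 hf (y 2) (hy 2)
  obtain ⟨dA, hverA⟩ := exists_veroneseNormalised_symChart (p := p) 2 e₀ τ₀ hp.pos hσp₀ hσJ ![] 𝒜 hf (y 1) (hy 1) (hσy 1) Ψ hΨ0 (htame' 1) 2 dg2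
  obtain ⟨dB, hverB⟩ := exists_veroneseNormalised_symChart (p := p) 2 e₀ τ₀ hp.pos hσp₀ hσJ ![] 𝒜 hf (y 2) (hy 2) (hσy 2) Ψ hΨ0 (htame' 2) 1 dg1
  have hdA : 0 < dA := hverA.1
  have hdB : 0 < dB := hverB.1
  have hd₂ : 0 < dA * dB := Nat.mul_pos hdA hdB
  have hdvd1 : (X (some 1) : MvPolynomial (Option (Fin 4)) k) ∣ Ψ (coverElement 𝒜 (e₀.symm ∘ ![X 0, X 1, X 2]) ![2 + 1, 1, 1] (d * ((2 + 1) * 2 * p)) (y 1) (hy 1)) := by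
    rw [hΨc1]; exact Sym.sym_normModel_dvd k 1 2 _ hed
  have hdvd2 : (X (some 2) : MvPolynomial (Option (Fin 4)) k) ∣ Ψ (coverElement 𝒜 (e₀.symm ∘ ![X 0, X 1, X 2]) ![2 + 1, 1, 1] (d * ((2 + 1) * 2 * p)) (y 2) (hy 2)) := by
    rw [hΨc2]; exact Sym.sym_normModel_dvd k 2 2 _ hed
  have hdvd0 : (X (some 0) : MvPolynomial (Option (Fin 4)) k) ∣ Ψ (coverElement 𝒜 (e₀.symm ∘ ![X 0, X 1, X 2]) ![2 + 1, 1, 1] (d * ((2 + 1) * 2 * p)) (y 0) (hy 0)) := by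
    rw [hΨc0]; exact dvd_pow_self _ (Nat.mul_pos two_pos hdp).ne'
  have hcov1 : ∀ x : M₁.V, x ∈ (OW 1).1 ∨ ∃ i, x ∈ (![(OW 0).1, (OW 2).1] : Fin 2 → M₁.V.Opens) i := fun x => by
    rcases hcovM x with h | h | h
    · exact Or.inr ⟨0, h⟩
    · exact Or.inl h
    · exact Or.inr ⟨1, h⟩
  have hcov2 : ∀ x : M₁.V, x ∈ (OW 2).1 ∨ ∃ i, x ∈ (![(OW 0).1, (OW 1).1] : Fin 2 → M₁.V.Opens) i := fun x => by
    rcases hcovM x with h | h | h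
    · exact Or.inr ⟨0, h⟩
    · exact Or.inr ⟨1, h⟩
    · exact Or.inl h
  -- ### member A: the component `V(X₀′, X₂′)` on the chart `N(x₁)`
  have ht : e₀.symm (X 1 * X 2) ∈ (weightedFiltration (e₀.symm ∘ ![X 0, X 1, X 2] : Fin 3 → Γ(X', O.1)) ![2 + 1, 1, 1]).ideal 2 := by
    rw [map_mul]
    exact (weightedFiltration (e₀.symm ∘ ![X 0, X 1, X 2] : Fin 3 → Γ(X', O.1)) ![2 + 1, 1, 1]).mul_le 1 1 (Ideal.mul_mem_mul hX1 hr)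
  have hT' : cobordantAlgebra.subst k (![2 + 1, 1, 1, 0] : Fin 4 → ℕ) (X 1 * X 2 : MvPolynomial (Fin 4) k) = X none ^ 2 * (X (some 1) * X (some 2)) := by
    rw [map_mul, cobordantAlgebra.subst, MvPolynomial.eval₂Hom_X', MvPolynomial.eval₂Hom_X']
    change X none ^ 1 * X (some 1) * (X none ^ 1 * X (some 2)) = _
    ring
  obtain ⟨JA, hJA, hJAW, hJAsupp, hJAoff⟩ := exists_isPrincipalCentre_of_symChart hG σ hC h0 h1 h2 2 (X 1 * X 2) h3 e₀ τ₀ hact₀ ht hp.pos hσp₀ hσJ ![] 𝒜 hf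
    (y 1) (hy 1) (hσy 1) Ψ hΨa hΨs hΨ0 hΨ1 hΨ2 (X (some 1) * X (some 2)) hT' M₁ (OW 1) (hOWaff 1) (E 1) (htame' 1) (hE 1) 2 (by decide)
    (Sym.sym_model_row_two σ h2 2 e₀ τ₀ hact₀ hp.pos hσp₀ hσJ Ψ hΨs hΨ0 hΨ2 ![] 𝒜 (y 1) (hy 1) (hσy 1)) dg2 (X (some 1)) rfl hdvd1
    (fun o => if o = some 1 then (1 : k) else 0) (if_neg (by decide)) (if_neg (by decide)) (by rw [hΨc1]; exact Sym.sym_eval_normModel_ne_zero k 1 one_ne_zero 2 _)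
    dA dB hdB hverA (![(OW 0).1, (OW 2).1] : Fin 2 → M₁.V.Opens) hcov1 ![t₁₀, t₁₂]
    ![coverElement 𝒜 (e₀.symm ∘ ![X 0, X 1, X 2]) ![2 + 1, 1, 1] (d * ((2 + 1) * 2 * p)) (y 0) (hy 0), coverElement 𝒜 (e₀.symm ∘ ![X 0, X 1, X 2]) ![2 + 1, 1, 1] (d * ((2 + 1) * 2 * p)) (y 2) (hy 2)]
    (fun i => Fin.cases ht₁₀E (fun i' => Fin.cases ht₁₂E (fun i'' => i''.elim0) i') i) (fun i => Fin.cases (Or.inl hdvd0) (fun i' => Fin.cases (Or.inr hdvd2) (fun i'' => i''.elim0) i') i)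
    (fun i => Fin.cases ht₁₀U (fun i' => Fin.cases ht₁₂U (fun i'' => i''.elim0) i') i)
  -- ### member B: the component `V(X₀′, X₁′)` on the chart `N(x₂)`
  obtain ⟨JB, hJB, hJBW, hJBsupp, hJBoff⟩ := exists_isPrincipalCentre_of_symChart hG σ hC h0 h1 h2 2 (X 1 * X 2) h3 e₀ τ₀ hact₀ ht hp.pos hσp₀ hσJ ![] 𝒜 hf
    (y 2) (hy 2) (hσy 2) Ψ hΨa hΨs hΨ0 hΨ1 hΨ2 (X (some 1) * X (some 2)) hT' M₁ (OW 2) (hOWaff 2) (E 2) (htame' 2) (hE 2) 1 (by decide)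
    (Sym.sym_model_row_one σ h1 2 e₀ τ₀ hact₀ hp.pos hσp₀ hσJ Ψ hΨs hΨ0 hΨ1 ![] 𝒜 (y 2) (hy 2) (hσy 2)) dg1 (X (some 2)) (mul_comm _ _) hdvd2
    (fun o => if o = some 2 then (1 : k) else 0) (if_neg (by decide)) (if_neg (by decide)) (by rw [hΨc2]; exact Sym.sym_eval_normModel_ne_zero k 2 (by decide) 2 _)
    dB dA hdA hverB (![(OW 0).1, (OW 1).1] : Fin 2 → M₁.V.Opens) hcov2 ![t₂₀, t₂₁]
    ![coverElement 𝒜 (e₀.symm ∘ ![X 0, X 1, X 2]) ![2 + 1, 1, 1] (d * ((2 + 1) * 2 * p)) (y 0) (hy 0), coverElement 𝒜 (e₀.symm ∘ ![X 0, X 1, X 2]) ![2 + 1, 1, 1] (d * ((2 + 1) * 2 * p)) (y 1) (hy 1)]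
    (fun i => Fin.cases ht₂₀E (fun i' => Fin.cases ht₂₁E (fun i'' => i''.elim0) i') i) (fun i => Fin.cases (Or.inl hdvd0) (fun i' => Fin.cases (Or.inr hdvd1) (fun i'' => i''.elim0) i') i)
    (fun i => Fin.cases ht₂₀U (fun i' => Fin.cases ht₂₁U (fun i'' => i''.elim0) i') i)
  rw [Nat.mul_comm dB dA] at hJB hJBW hJBsupp hJBoff
  -- ### MOVE 2: the parallel kill of the two components
  refine killsIn_one_of_disjointPrincipalFamily_datum hp hG φ M₁ 𝔄₁ (![JA, JB] : Fin 2 → ReesFiltration M₁.V) hd₂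
    (fun i => by fin_cases i; exacts [hJA, hJB]) ?_ id (![OW 1, OW 2] : Fin 2 → M₁.act.StableAffineOpens)
    (fun c => by fin_cases c; exacts [hJAW, hJBW]) ?_ hF₁W
  · intro i j hij
    fin_cases i <;> fin_cases j
    · exact absurd rfl hij
    · exact (hJBoff 1).mono_left hJAsupp
    · exact (hJAoff 1).mono_left hJBsupp
    · exact absurd rfl hij
  · intro c j hj
    fin_cases c <;> fin_cases j
    · exact absurd rfl hj
    · exact hJBoff 1
    · exact hJAoff 1
    · exact absurd rfl hj

end Summit.ResolutionOfSingularities.ResolutionOfSingularities.Theorems.WildQuotientResolution.S1.GameFrame.GModel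

end
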